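/-
Copyright (c) 2026. All rights reserved.
Released under Apache 2.0 license as described in the file LICENSE.
Authors: abc-iut cell, seat abc-iut-L4-t9 (gen 6; block W2-B2 — the residual input `θ^bi` of [AbsTopIII]
Cor 3.7 (ii) at the model, decomposed).
-/
import Literature.AnabelianGeometry.AbsoluteAnabelian.AbsTopIII.BiAnabelianModelLiftOfFull
import Literature.AnabelianGeometry.AbsoluteAnabelian.MonoidKummerMapsSub
import Literature.AnabelianGeometry.AbsoluteAnabelian.MonoidKummerMapsIdRigidTFProofs
import Literature.NumberTheory.GaloisRepresentations.LocalFieldFiniteExtension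
import Literature.NumberTheory.GaloisRepresentations.LocalFieldPadicProofs
import HarnessLib

/-!
# [AbsTopIII] Cor 3.7 (ii) at the model: `θ^bi` ⟺ fullness of `(Π ↷ M) ↦ Π` ⟺
# (every `Π_A ⥲ Π_B` respects the arithmetic quotients) ∧ (the `TF` bijectivity schema of Prop 3.2 (iv))

S. Mochizuki, *Topics in absolute anabelian geometry III* [MochizukiAbsTopIII2015] (kurims manuscript
`paper:url-5493eb38cbb7`, read on the page).  Cor 3.7 (ii) p. 87: `θ^bi` "arises from the functoriality —
i.e., the bi-anabelian [...] portion [...] — of the 'group-theoretic' algorithms of Corollary 1.10";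
Prop 3.2 (iv) p. 72 l. 16–21: "the natural functor of Definition 3.1, (iii), induces an injection
`Isom_{𝒞^MLF_T}((Π ↷ M_T), (Π* ↷ M*_T)) ↪ Isom_{𝒯𝒢}(Π, Π*)` [...] this injection is a bijection if [...]
`(Π ↷ M_T)`, `(Π* ↷ M*_T)` are of strictly Belyi type"; Def 3.1 (ii) p. 67: a morphism of pairs
"induces an open injective homomorphism between the respective arithmetic Galois groups", an object
of `𝒯𝒢` is `Π` "regarded as equipped with the quotient `Π ↠ G`" (Def 3.1 (iii) p. 68 l. 3–6).

PROOF-ONLY companion (theorems only, no new definitions) of this seat's gen-4 file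
`BiAnabelianModelLiftOfFull.lean`, which pinned the residual input of Cor 3.7 at the `P`-sub-model of
the model category `𝒳 = TFModel p` to ONE property, `(P.ι ⋙ TFModel.gal p).Full` ("every isomorphism of
topological groups `Π_A ⥲ Π_B` between `P`-objects is the Galois component of a morphism of pairs"), and
of abc-iut-w4-d045's `MonoidKummerMapsSub.lean` (the `TF` bijectivity clause of Prop 3.2 (iv) as the schema
`GaloisIsoLiftsToTFPairIsoOfStrictlyBelyi H`, FACT-LIST F-2995).  Contents:

* `TFModel.isMLFGaloisFieldPair_pair` — BRIDGE: every model object `(Π_k ↷ ℚ̄_p)` IS an MLF-Galois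
  `TF`-pair in abc-iut-L4-t2's abstract sense (`k ⊆ ℚ̄_p` finite over `ℚ_p` is a non-archimedean local
  field for the prolonged valuation — the tree's `FiniteExtension.isNonarchimedeanLocalField` — and
  `ℚ̄_p` is an algebraic closure of `k`);
* `TFModel.nonempty_biAnabelianLift_iff_full` — gen 4's two directions as one `iff`:
  `θ^bi` for the `P`-sub-model exists iff `(P.ι ⋙ gal).Full`;
* `TFModel.full_ι_gal_iff_forall_exists_iso` — fullness ⟺ every `f : Π_A ⥲ Π_B` (`A, B ∈ P`) is the
  Galois component of an ISOMORPHISM OF PAIRS `(Π_A ↷ ℚ̄_p) ⥲ (Π_B ↷ ℚ̄_p)` (`𝒳` is a groupoid,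
  `TFModel.Hom.galois`);
* `TFModel.full_ι_gal_iff_ker_and_lifts` — ⟺ (a) every such `f` maps the arithmetic kernel
  `Ker(Π_A ↠ Aut k̄)` onto `Ker(Π_B ↠ Aut k̄)` ("respects the arithmetic quotients": in print part of the
  DEFINITION of `𝒯𝒢`, Def 3.1 (iii); our `𝔈 = TopGroupObj` forgets the quotient, so at the model it is a
  CONDITION — for strictly Belyi type it is the group-theoreticity of `Π ↠ G`, [AbsTopI] Thm 2.6 /
  [AbsAnab] Lem 1.1.4) AND (b) every such `f` respecting the kernels lifts to an isomorphism of pairs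
  (the SHAPE of F-2995 at model objects);
* `TFModel.full_ι_gal_iff_ker_and_galoisIsoLiftsToTFPairIso` — ⟺ (a) ∧ F-2995 AT THE HYPOTHESIS
  PREDICATE "is the pair of a `P`-object" (by the bridge);
* `TFModel.swapObj_not_map_actionKer` / `not_forall_map_actionKer_slim` — at `P` = slim `Π_k` it is
  conjunct (a) that FAILS (the factor swap of `Π = G × G ↠ G` of `BiAnabelianModelLiftVacuity` moves
  `Ker = 1 × G` to `G × 1`), which is the content of gen 4's `not_full_gal_slim`; nothing is claimed about
  F-2995 at slim pairs.

BOOKKEEPING CONSEQUENCE (ours): the residual of Cor 3.7 (ii)/(iv)-second at the `P`-sub-model is the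
CONJUNCTION of two named inputs — kernel preservation on `P` (print: automatic in `𝒯𝒢`; group-theoretic
for strictly Belyi type by [AbsTopI] Thm 2.6) and F-2995|`P` (Cor 1.10 (h)) — consistent with this seat's
`MLFGaloisLogFrobeniusResidualProofs` (Prop 3.2 (v) on isomorphisms ⟺ F-2995|`S`).  HONEST FRAMING:
refereed pre-IUT material; OUR kernel theorems about OUR model; a residual decomposition is bookkeeping,
not a discharge; F-2995 is neither asserted nor refuted.  No instance, no notation, no definition.
Nothing here bears on [IUTchIII] Cor 3.12 or takes a side; typed ≠ proved.
-/

set_option autoImplicit false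

noncomputable section

namespace Literature.AnabelianGeometry.AbsoluteAnabelian.AbsTopIII

open CategoryTheory
open Literature.AlgebraicGeometry.Frobenioids (IsSlimGroup)
open Literature.NumberTheory.GaloisRepresentations

namespace TFModel

variable {p : ℕ} [hp : Fact p.Prime]

/-! ## Bridge: model objects are MLF-Galois `TF`-pairs -/

/-- **Every model object `(Π_k ↷ ℚ̄_p)` is an MLF-Galois `TF`-pair** in the abstract sense of Def 3.1 (ii)
(abc-iut-L4-t2's `IsMLFGaloisFieldPair`): `k` (finite over `ℚ_p` inside `ℚ̄_p`) is a non-archimedean local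
field of characteristic `0` for the prolonged valuation (`FiniteExtension.isNonarchimedeanLocalField`), `ℚ̄_p` is an
algebraic closure of `k`, and the pair is the model pair of these data (identity isomorphism).
[cite: MochizukiAbsTopIII2015, Definition 3.1 (ii) p.67] -/
theorem isMLFGaloisFieldPair_pair (A : TFModel p) : IsMLFGaloisFieldPair A.pair := by
  haveI : IsNonarchimedeanLocalField ℚ_[p] := Padic.isNonarchimedeanLocalField_holds p
  letI := FiniteExtension.valuativeRel ℚ_[p] A.k
  letI := FiniteExtension.topologicalSpace ℚ_[p] A.k
  haveI := FiniteExtension.isNonarchimedeanLocalField ℚ_[p] A.k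
  haveI : IsAlgClosure A.k (PadicAlgCl p) :=
    { isAlgClosed := inferInstance, isAlgebraic := A.isAlgebraic }
  let C : MLFClosure.{0} := { k := ↥A.k, K := PadicAlgCl p }
  exact ⟨⟨C, A.D, ⟨GaloisFieldPair.Iso.refl' _⟩⟩⟩

/-! ## `θ^bi` ⟺ fullness (gen 4's two directions) -/

/-- **`θ^bi` for the `P`-sub-model exists iff `(Π ↷ M) ↦ Π` is full on `𝒳_P`** (`biAnabelianLiftOfFull` /
`full_of_biAnabelianLift`). [cite: MochizukiAbsTopIII2015, Cor 3.7 (ii) p.87] -/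
theorem nonempty_biAnabelianLift_iff_full (P : ObjectProperty (TFModel p)) :
    Nonempty (FiberSquare.BiAnabelianLift ((modelSetting p).restrict P fun _ h => h).gal) ↔
      (P.ι ⋙ TFModel.gal p).Full :=
  ⟨fun ⟨θ⟩ => full_of_biAnabelianLift p P θ, fun h => ⟨biAnabelianLiftOfFull p P h⟩⟩

/-! ## Fullness ⟺ every `Π_A ⥲ Π_B` lifts to an isomorphism of pairs -/

/-- An isomorphism of `TF`-pairs maps the arithmetic kernel onto the arithmetic kernel (its Galois component
"respects the arithmetic quotients"). [cite: MochizukiAbsTopIII2015, Definition 3.1 (ii) p.67] -/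
theorem _root_.Literature.AnabelianGeometry.AbsoluteAnabelian.GaloisFieldPair.Iso.map_actionKer
    {P Q : GaloisFieldPair.{0}} (e : GaloisFieldPair.Iso P Q) :
    P.actionKer.map e.isoPi.toMulEquiv.toMonoidHom = Q.actionKer := by
  ext h
  rw [Subgroup.mem_map]
  constructor
  · rintro ⟨g, hg, rfl⟩
    rw [GaloisFieldPair.mem_actionKer_iff] at hg ⊢
    intro y
    obtain ⟨x, rfl⟩ := e.isoM.surjective y
    change e.isoPi g • e.isoM x = e.isoM x
    rw [← e.smul_comm, hg]
  · intro hh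
    refine ⟨e.isoPi.symm h, ?_, ContinuousMulEquiv.apply_symm_apply _ _⟩
    rw [GaloisFieldPair.mem_actionKer_iff] at hh ⊢
    intro x
    apply e.isoM.injective
    rw [e.smul_comm, ContinuousMulEquiv.apply_symm_apply, hh]

/-- **`(Π ↷ M) ↦ Π` is full on `𝒳_P` iff every isomorphism of topological groups `Π_A ⥲ Π_B` between
`P`-objects is the Galois component of an ISOMORPHISM OF PAIRS** `(Π_A ↷ ℚ̄_p) ⥲ (Π_B ↷ ℚ̄_p)` (a
Galois-isomorphism of model pairs has `φ_M ∈ Gal(ℚ̄_p/ℚ_p)`, gen 3's `Hom.galois`).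
[cite: MochizukiAbsTopIII2015, Proposition 3.2 (iv) p.72] -/
theorem full_ι_gal_iff_forall_exists_iso (P : ObjectProperty (TFModel p)) :
    (P.ι ⋙ TFModel.gal p).Full ↔
      ∀ A B : TFModel p, P A → P B → ∀ f : A.pair.Pi ≃ₜ* B.pair.Pi,
        ∃ e : GaloisFieldPair.Iso A.pair B.pair, e.isoPi = f := by
  constructor
  · intro h A B hA hB f
    obtain ⟨g, hg⟩ := h.map_surjective (X := ⟨A, hA⟩) (Y := ⟨B, hB⟩) (⟨f⟩ : (gal p).obj A ⟶ (gal p).obj B)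
    let gh : Hom A B := g.hom
    refine ⟨{ isoPi := gh.piIso, isoM := gh.galois.toRingEquiv,
              smul_comm := fun x y => gh.hom.smul_comm x y }, ?_⟩
    ext x
    have h1 := congrArg (fun φ : TopGroupObj.Hom _ _ => φ.iso x) hg
    exact h1
  · intro h
    refine ⟨fun {X Y} φ => ?_⟩
    obtain ⟨e, he⟩ := h X.obj Y.obj X.property Y.property (φ : TopGroupObj.Hom _ _).iso
    let g : X.obj ⟶ Y.obj := (⟨e.toHom, e.isoPi.bijective, e.isoPi.isOpenMap⟩ : Hom X.obj Y.obj)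
    refine ⟨ObjectProperty.homMk g, TopGroupObj.Hom.ext fun x => ?_⟩
    change e.isoPi x = (φ : TopGroupObj.Hom _ _).iso x
    rw [he]
    rfl

/-! ## Fullness ⟺ (kernels respected) ∧ (the `TF` bijectivity shape of Prop 3.2 (iv)) -/

/-- **`(Π ↷ M) ↦ Π` is full on `𝒳_P` iff (a) every `Π_A ⥲ Π_B` between `P`-objects maps `Ker(Π_A ↠ Aut k̄)` onto
`Ker(Π_B ↠ Aut k̄)` AND (b) every such isomorphism respecting the kernels lifts to an isomorphism of pairs** —
(b) is the SHAPE of the `TF` bijectivity clause of Prop 3.2 (iv) at model objects; (a) is what print builds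
into `𝒯𝒢` ("`Π` regarded as equipped with the quotient `Π ↠ G`") and what [AbsTopI] Thm 2.6 makes
group-theoretic for strictly Belyi type. [cite: MochizukiAbsTopIII2015, Proposition 3.2 (iv) p.72] -/
theorem full_ι_gal_iff_ker_and_lifts (P : ObjectProperty (TFModel p)) :
    (P.ι ⋙ TFModel.gal p).Full ↔
      (∀ A B : TFModel p, P A → P B → ∀ f : A.pair.Pi ≃ₜ* B.pair.Pi,
          A.pair.actionKer.map f.toMulEquiv.toMonoidHom = B.pair.actionKer) ∧
      (∀ A B : TFModel p, P A → P B → ∀ f : A.pair.Pi ≃ₜ* B.pair.Pi,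
          A.pair.actionKer.map f.toMulEquiv.toMonoidHom = B.pair.actionKer →
            ∃ e : GaloisFieldPair.Iso A.pair B.pair, e.isoPi = f) := by
  rw [full_ι_gal_iff_forall_exists_iso]
  refine ⟨fun h => ⟨fun A B hA hB f => ?_, fun A B hA hB f _ => h A B hA hB f⟩,
    fun h A B hA hB f => h.2 A B hA hB f (h.1 A B hA hB f)⟩
  obtain ⟨e, rfl⟩ := h A B hA hB f
  exact e.map_actionKer

/-- **`(Π ↷ M) ↦ Π` is full on `𝒳_P` iff (a) kernels are respected on `P` AND the `TF` bijectivity schema of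
Prop 3.2 (iv) (`GaloisIsoLiftsToTFPairIsoOfStrictlyBelyi`, F-2995) holds at the hypothesis predicate "is the pair
of a `P`-object"** (the model objects ARE MLF-Galois `TF`-pairs, `isMLFGaloisFieldPair_pair`).  So the residual
of Cor 3.7 (ii) at the `P`-sub-model (`θ^bi`, `nonempty_biAnabelianLift_iff_full`) is the conjunction of
kernel preservation on `P` and F-2995|`P`. [cite: MochizukiAbsTopIII2015, Cor 3.7 (ii) p.87] -/
theorem full_ι_gal_iff_ker_and_galoisIsoLiftsToTFPairIso (P : ObjectProperty (TFModel p)) :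
    (P.ι ⋙ TFModel.gal p).Full ↔
      (∀ A B : TFModel p, P A → P B → ∀ f : A.pair.Pi ≃ₜ* B.pair.Pi,
          A.pair.actionKer.map f.toMulEquiv.toMonoidHom = B.pair.actionKer) ∧
      GaloisIsoLiftsToTFPairIsoOfStrictlyBelyi (fun Q => ∃ A : TFModel p, P A ∧ A.pair = Q) := by
  rw [full_ι_gal_iff_ker_and_lifts]
  refine and_congr_right fun _ => ⟨fun h => ?_, fun h A B hA hB f hf => ?_⟩
  · rintro P' Q' - - ⟨A, hA, rfl⟩ ⟨B, hB, rfl⟩ f hf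
    exact h A B hA hB f hf
  · exact h A.pair B.pair A.isMLFGaloisFieldPair_pair B.isMLFGaloisFieldPair_pair ⟨A, hA, rfl⟩ ⟨B, hB, rfl⟩ f hf

/-- Hence: **`θ^bi` for the `P`-sub-model exists iff kernels are respected on `P` and F-2995 holds on `P`.**
[cite: MochizukiAbsTopIII2015, Cor 3.7 (ii) p.87] -/
theorem nonempty_biAnabelianLift_iff_ker_and_galoisIsoLiftsToTFPairIso (P : ObjectProperty (TFModel p)) :
    Nonempty (FiberSquare.BiAnabelianLift ((modelSetting p).restrict P fun _ h => h).gal) ↔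
      (∀ A B : TFModel p, P A → P B → ∀ f : A.pair.Pi ≃ₜ* B.pair.Pi,
          A.pair.actionKer.map f.toMulEquiv.toMonoidHom = B.pair.actionKer) ∧
      GaloisIsoLiftsToTFPairIsoOfStrictlyBelyi (fun Q => ∃ A : TFModel p, P A ∧ A.pair = Q) :=
  (nonempty_biAnabelianLift_iff_full P).trans (full_ι_gal_iff_ker_and_galoisIsoLiftsToTFPairIso P)

/-! ## At `P` = slim it is the kernel condition that fails -/

/-- **The factor swap of `Π = G × G ↠ G` does NOT respect the arithmetic quotient**: the kernel of the action
of `swapObj` on `ℚ̄_p` is `1 × G`, whose image under the swap is `G × 1 ≠ 1 × G` (`G = G_{ℚ_p} ≠ 1`: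
`σ₀(√p) = -√p`).  So at the slim sub-model conjunct (a) of `full_ι_gal_iff_ker_and_lifts` fails — this is the
content of gen 4's `not_full_gal_slim`. [cite: MochizukiAbsTopIII2015, Proposition 3.2 (iv) p.72] -/
theorem swapObj_not_map_actionKer :
    (swapObj p).pair.actionKer.map (swapEquiv p).toMulEquiv.toMonoidHom ≠ (swapObj p).pair.actionKer := by
  intro h
  obtain ⟨σ₀, hσ₀⟩ := exists_algEquiv_neg_sqrtPrime p
  -- `(1, σ₀) ∈ Ker`, hence its swap `(σ₀, 1) ∈ Ker`
  have hmem : (((1 : GalBot p), liftBot p σ₀) : (swapObj p).pair.Pi) ∈ (swapObj p).pair.actionKer :=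
    (mem_pair_actionKer_iff (A := swapObj p) _).mpr fun x => by
      rw [swapObj_augQ_apply]
      exact AlgEquiv.one_apply x
  have hmem' : ((liftBot p σ₀, (1 : GalBot p)) : (swapObj p).pair.Pi) ∈ (swapObj p).pair.actionKer := by
    rw [← h]
    exact Subgroup.mem_map.mpr ⟨_, hmem, rfl⟩
  have e1 := (mem_pair_actionKer_iff (A := swapObj p) _).mp hmem' (sqrtPrime p)
  rw [swapObj_augQ_apply] at e1
  change liftBot p σ₀ (sqrtPrime p) = sqrtPrime p at e1
  rw [liftBot_apply, hσ₀] at e1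
  exact neg_sqrtPrime_ne p e1

/-- **At the slim sub-model, kernel preservation fails** (the swap object has slim `Π = G × G`); in particular
gen 4's `not_full_gal_slim` is conjunct (a) of `full_ι_gal_iff_ker_and_lifts` failing, and NOTHING is thereby
said about F-2995 at slim pairs.
[cite: MochizukiAbsTopIII2015, Proposition 3.2 (iv) p.72] -/
theorem not_forall_map_actionKer_slim :
    ¬ ∀ A B : TFModel p, IsSlimGroup A.pair.Pi → IsSlimGroup B.pair.Pi → ∀ f : A.pair.Pi ≃ₜ* B.pair.Pi,
        A.pair.actionKer.map f.toMulEquiv.toMonoidHom = B.pair.actionKer := fun h =>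
  swapObj_not_map_actionKer (h (swapObj p) (swapObj p) (swapObj_isSlim p) (swapObj_isSlim p) (swapEquiv p))

end TFModel

end Literature.AnabelianGeometry.AbsoluteAnabelian.AbsTopIII

end

/-! ## v2 (append-only; abc-iut-L4-t9 gen 6, 2026-08-26): faithful-action sub-models — conjunct (a) is automatic

For model objects whose `Π_k` acts FAITHFULLY on `ℚ̄_p` (`ε_k : Π_k ↠ G_k` injective, e.g. the genuine
mono-analytic objects `Π_k = G_k` of Def 3.1 (ii)) the arithmetic kernels are trivial, so conjunct (a) of
`TFModel.full_ι_gal_iff_ker_and_lifts` holds for nothing and the residual of Cor 3.7 (ii) at such a sub-model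
is F-2995|`P` ALONE: "every isomorphism of topological groups `Π_A ⥲ Π_B` lifts to an isomorphism of the
field pairs".  (For bare MLF data — `Π = G_k` — print expects this to FAIL, cf. the docstring of
abc-iut-L6-t13's `MonoidKummerMapsStrictlyBelyiTMLift` «Jarden–Ritter / Yamagata»; NOT decided in kernel
here.  Print's strictly-Belyi objects have `Ker = Δ_X ≠ 1`, where (a) is substantive: [AbsTopI] Thm 2.6.)
HONEST FRAMING as in the header: bookkeeping, no discharge, no side taken on [IUTchIII] Cor 3.12. -/

namespace Literature.AnabelianGeometry.AbsoluteAnabelian.AbsTopIII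

open CategoryTheory

namespace TFModel

variable {p : ℕ} [hp : Fact p.Prime]

/-- A model object whose Galois augmentation `ε_k : Π_k → G_k` is injective (a FAITHFUL action of `Π_k` on
`ℚ̄_p`, e.g. `Π_k = G_k` of mono-analytic type) has trivial arithmetic kernel.
[cite: MochizukiAbsTopIII2015, Definition 3.1 (ii) p.67] -/
theorem pair_actionKer_eq_bot_of_injective (A : TFModel p) (hA : Function.Injective A.D.aug) :
    A.pair.actionKer = ⊥ := by
  rw [eq_bot_iff]
  intro g hg
  rw [mem_pair_actionKer_iff] at hg
  rw [Subgroup.mem_bot]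
  have h1 : A.D.aug g = 1 := by
    ext x
    rw [AlgEquiv.one_apply]
    exact hg x
  exact hA (h1.trans (map_one A.D.aug).symm)

/-- **On a sub-model of faithful actions, kernels are respected for nothing** (conjunct (a) of
`full_ι_gal_iff_ker_and_lifts`: both kernels are `⊥`). [cite: MochizukiAbsTopIII2015, Definition 3.1 (iii) p.68] -/
theorem forall_map_actionKer_of_injective (P : ObjectProperty (TFModel p))
    (hP : ∀ A : TFModel p, P A → Function.Injective A.D.aug) :
    ∀ A B : TFModel p, P A → P B → ∀ f : A.pair.Pi ≃ₜ* B.pair.Pi,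
      A.pair.actionKer.map f.toMulEquiv.toMonoidHom = B.pair.actionKer := by
  intro A B hA hB f
  rw [pair_actionKer_eq_bot_of_injective A (hP A hA), pair_actionKer_eq_bot_of_injective B (hP B hB),
    Subgroup.map_bot]

/-- **On a sub-model of faithful actions (e.g. the genuine mono-analytic objects `Π_k = G_k`):
`(Π ↷ M) ↦ Π` is full on `𝒳_P` iff F-2995 holds on `P`** — the residual of Cor 3.7 (ii) there is EXACTLY the
`TF` bijectivity schema of Prop 3.2 (iv) ("every `Π_A ⥲ Π_B` lifts to the field pairs"; for bare MLF data print
expects failure — not decided here). [cite: MochizukiAbsTopIII2015, Proposition 3.2 (iv) p.72] -/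
theorem full_ι_gal_iff_galoisIsoLiftsToTFPairIso_of_injective (P : ObjectProperty (TFModel p))
    (hP : ∀ A : TFModel p, P A → Function.Injective A.D.aug) :
    (P.ι ⋙ TFModel.gal p).Full ↔
      GaloisIsoLiftsToTFPairIsoOfStrictlyBelyi (fun Q => ∃ A : TFModel p, P A ∧ A.pair = Q) := by
  rw [full_ι_gal_iff_ker_and_galoisIsoLiftsToTFPairIso]
  exact ⟨fun h => h.2, fun h => ⟨forall_map_actionKer_of_injective P hP, h⟩⟩

/-- Hence on a sub-model of faithful actions: **`θ^bi` exists iff F-2995 holds on `P`.**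
[cite: MochizukiAbsTopIII2015, Cor 3.7 (ii) p.87] -/
theorem nonempty_biAnabelianLift_iff_galoisIsoLiftsToTFPairIso_of_injective (P : ObjectProperty (TFModel p))
    (hP : ∀ A : TFModel p, P A → Function.Injective A.D.aug) :
    Nonempty (FiberSquare.BiAnabelianLift ((modelSetting p).restrict P fun _ h => h).gal) ↔
      GaloisIsoLiftsToTFPairIsoOfStrictlyBelyi (fun Q => ∃ A : TFModel p, P A ∧ A.pair = Q) :=
  (nonempty_biAnabelianLift_iff_full P).trans (full_ι_gal_iff_galoisIsoLiftsToTFPairIso_of_injective P hP)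

end TFModel

end Literature.AnabelianGeometry.AbsoluteAnabelian.AbsTopIII
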